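import Literature.NumberTheory.Transcendental.QuantitativeCIAPolynomial
import Literature.NumberTheory.Transcendental.PhilipponCriterionMainLt
import HarnessLib

/-!
# The quantitative criterion for integer families (Ably 1994, §I "Critère", affine form) — proofs only

`Literature/NumberTheory/Transcendental/QuantitativeCIAAffine.lean` — proofs only (no
definitions, no named facts, nothing asserted). Third step towards the named fact
`Ably1994_lindemannWeierstrass_measure` (`LindemannWeierstrassMeasure.lean`): the AFFINE,
integer-coefficient reading of the quantitative criterion `QuantCIA.exists_const_polynomial_measure`
(`QuantitativeCIAPolynomial.lean`). That theorem asks, at every scale `τ < Sσ^{k+1} ≤ U`, for a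
finite family of HOMOGENEOUS forms `E_j ∈ ℚ[x₀, …, x_m]` with `deg E_j ≤ δ`, `h(E_j) ≤ τ`,
`‖E_j‖_ω̄ ≤ exp(−Sσ^{k+1})` (`ω̄ = (1, θ)`) and no common zero `(1 : z)` in the polydisc
`max |z_i − θ_i| < exp(−Sσ^{k+2})`. Ably's printed Critère (Acta Arith. 67 (1994), p. 31) is
stated for AFFINE polynomials `Q_{S,j} ∈ K[X₁, …, Xₙ]`; here (`K = ℚ`, integer coefficients) we
pass from a finite family `Q_i ∈ ℤ[X₁, …, X_m]` with `deg Q_i ≤ δ`, `log L(Q_i) ≤ τ` (`L` the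
`ℓ¹`-norm `Chudnovsky.l1`), `|Q_i(θ)| ≤ exp(−Sσ^{k+1})` and no common zero in the polydisc, to such
a homogeneous family by homogenisation `Q ↦ ʰQ` (`PhilipponMain.exists_homogenization`:
`deg ʰQ = deg Q`, `h(ʰQ) ≤ log H(Q) ≤ log L(Q)`, `‖ʰQ‖_ω̄ ≤ |Q(θ)|`, `ʰQ(1, z) = Q(z)`), exactly as
in Philippon's proof of his criterion (Publ. Math. IHÉS 64 (1986), §3 p. 41) and in
`PhilipponMain.exists_setup`.

What is proved (`QuantCIA.exists_const_affine_measure`): for `θ ∈ ℂ^m` with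
`trdeg_ℚ ℚ(θ) ≤ k + 1` (`k + 1 < m`) there is `C = C(θ, m, k) ≥ 1` such that, for `δ ≥ 1`,
`τ ≥ 2mδ`, `σ ≥ 1`, `U > τ` and affine integer families as above at every real scale
`τ < Sσ^{k+1} ≤ U`, every `P ∈ ℤ[X₁, …, X_m]` with `P(θ) ≠ 0`, `deg P ≥ 1` and
`C · K · (qδ)^k · (δ (deg P + log H(P)) + τ deg P) ≤ U` (`K = KConst m k σ θ`, `q = qConst m k σ`)
has `|P(θ)| > e^{−U}`.

## References

* [Ably1994] M. Ably, *Une version quantitative du théorème de Lindemann–Weierstrass*, Acta Arith.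
  67 (1994) 29–45, §I "Critère", p. 31.
* [NesterenkoPhilippon2001] Yu. V. Nesterenko, P. Philippon (eds.), LNM 1752 (2001), Ch. 3 §5
  (p. 44, the homogenisation); Ch. 8 (CIA) (PDF p. 162).
-/

noncomputable section

open MvPolynomial Real IntermediateField
open Literature.NumberTheory.Transcendental.Nesterenko
open Literature.NumberTheory.Transcendental.PhilipponMain

namespace Literature.NumberTheory.Transcendental

namespace QuantCIA

/-! ### Homogenising an affine family -/

/-- **Homogenisation of an affine integer family.** A finite family `Q_i ∈ ℤ[X₁, …, X_m]` with
`deg Q_i ≤ δ`, `log L(Q_i) ≤ τ` (`τ ≥ 1`), `|Q_i(θ)| ≤ e^{−S'}` and no common zero `z` with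
`max |z_i − θ_i| < ρ` yields, by `Q ↦ ʰQ` and re-indexing by `Fin (card ι)`, a family of
homogeneous forms `E_j ∈ ℚ[x₀, …, x_m]` of degrees `d_j ≤ δ` with `h(E_j) ≤ τ`,
`‖E_j‖_ω̄ ≤ e^{−S'}` at `ω̄ = (1, θ)` and no common zero `(1 : z)` with `max |z_i − θ_i| < ρ`.
[cite: NesterenkoPhilippon2001, Ch. 3 §5 (p. 44, `E = x₀ⁿ B(x₁/x₀, …)`) and Ch. 8 (CIA)] -/
theorem exists_homogeneous_family_of_affine {m : ℕ} (θ : Fin m → ℂ) {δ τ S' ρ : ℝ}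
    (h1τ : 1 ≤ τ) {ι : Type} [Fintype ι] (Q : ι → MvPolynomial (Fin m) ℤ)
    (hdeg : ∀ i, ((Q i).totalDegree : ℝ) ≤ δ)
    (hh : ∀ i, Real.log (Chudnovsky.l1 (Q i)) ≤ τ)
    (hsmall : ∀ i, ‖aeval θ (Q i)‖ ≤ exp (-S'))
    (hzero : ∀ z : Fin m → ℂ, (∀ i, ‖z i - θ i‖ < ρ) → ∃ i, aeval z (Q i) ≠ 0) :
    ∃ (M : ℕ) (E : Fin M → Rx m) (d : Fin M → ℕ),
      (∀ j, (E j).IsHomogeneous (d j)) ∧ (∀ j, (d j : ℝ) ≤ δ) ∧ (∀ j, height (E j) ≤ τ) ∧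
      (∀ j, normAt (Fin.cons 1 θ : Fin (m + 1) → ℂ) (E j) ≤ exp (-S')) ∧
      ∀ z : Fin m → ℂ, (∀ i, ‖z i - θ i‖ < ρ) →
        ∃ j, aeval (Fin.cons 1 z : Fin (m + 1) → ℂ) (E j) ≠ 0 := by
  classical
  choose E hE using fun i => exists_homogenization (Q i)
  set e := (Fintype.equivFin ι).symm with he
  refine ⟨Fintype.card ι, fun j => E (e j), fun j => (Q (e j)).totalDegree,
    fun j => (hE (e j)).1, fun j => hdeg (e j), fun j => ?_, fun j => ?_, fun z hz => ?_⟩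
  · exact height_le_of_homogenization_spec (hE (e j)).2.2.2.1 h1τ (hh (e j))
  · exact normAt_le_of_homogenization_spec (hE (e j)).2.1 (hE (e j)).2.2.1 (hsmall (e j))
  · obtain ⟨i, hi⟩ := hzero z hz
    refine ⟨e.symm i, ?_⟩
    have hei : e (e.symm i) = i := Equiv.apply_symm_apply e i
    show aeval (Fin.cons 1 z : Fin (m + 1) → ℂ) (E (e (e.symm i))) ≠ 0
    rw [hei, aeval_cons_one_of_homogenization (hE i).2.1 z]
    exact hi

/-! ### Ably's Critère over `ℚ`, affine form -/

/-- **Ably's Critère over `ℚ` for affine integer families (the affine quantitative criterion), with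
the constant depending on the point.** Let `k + 1 < m`, `θ ∈ ℂ^m` with `trdeg_ℚ ℚ(θ) ≤ k + 1`.
There is `C ≥ 1` (depending on `θ, m, k`) such that: for `δ ≥ 1`, `τ ≥ 2mδ`, `σ ≥ 1`, `U > τ`,
finite families `Q_i ∈ ℤ[X₁, …, X_m]` at every real scale `τ < Sσ^{k+1} ≤ U` with `deg Q_i ≤ δ`,
`log L(Q_i) ≤ τ`, `|Q_i(θ)| ≤ exp(−Sσ^{k+1})` and no common zero `z` with
`max |z_i − θ_i| < exp(−Sσ^{k+2})` (Ably's (a)–(e) with `K = ℚ`), and every `P ∈ ℤ[X₁, …, X_m]`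
with `P(θ) ≠ 0`, `deg P ≥ 1` and
`C · KConst m k σ θ · (qConst m k σ · δ)^k · (δ (deg P + log H(P)) + τ deg P) ≤ U` (the shape of
Ably's (f)), one has `|P(θ)| > e^{−U}`. Deduced from `exists_const_polynomial_measure` by
homogenising the families (`exists_homogeneous_family_of_affine`).
[cite: Ably1994, §I Critère p. 31]
[cite: NesterenkoPhilippon2001, Ch. 8 (CIA) (PDF p. 162); Ch. 3 §5 (p. 44)] -/
theorem exists_const_affine_measure {m k : ℕ} (hkm : k + 1 < m) (θ : Fin m → ℂ)
    (htr : Algebra.trdeg ℚ ↥(IntermediateField.adjoin ℚ (Set.range θ)) ≤ ((k + 1 : ℕ) : Cardinal)) :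
    ∃ C : ℝ, 1 ≤ C ∧ ∀ (δ τ σ U : ℝ), 1 ≤ δ → 2 * m * δ ≤ τ → 1 ≤ σ → τ < U →
      (∀ S : ℝ, τ < S * σ ^ (k + 1) → S * σ ^ (k + 1) ≤ U →
        ∃ (ι : Type) (_ : Fintype ι) (Q : ι → MvPolynomial (Fin m) ℤ),
          (∀ i, ((Q i).totalDegree : ℝ) ≤ δ) ∧
          (∀ i, Real.log (Chudnovsky.l1 (Q i)) ≤ τ) ∧
          (∀ i, ‖MvPolynomial.aeval θ (Q i)‖ ≤ Real.exp (-(S * σ ^ (k + 1)))) ∧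
          ∀ z : Fin m → ℂ, (∀ i, ‖z i - θ i‖ < Real.exp (-(S * σ ^ (k + 2)))) →
            ∃ i, MvPolynomial.aeval z (Q i) ≠ 0) →
      ∀ P : MvPolynomial (Fin m) ℤ, MvPolynomial.aeval θ P ≠ 0 → 1 ≤ P.totalDegree →
        C * KConst m k σ θ * (qConst m k σ * δ) ^ k *
            (δ * (P.totalDegree + Real.log (mvPolyHeight P)) + τ * P.totalDegree) ≤ U →
        Real.exp (-U) < ‖MvPolynomial.aeval θ P‖ := by
  obtain ⟨C, hC1, hC⟩ := exists_const_polynomial_measure hkm θ htr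
  refine ⟨C, hC1, fun δ τ σ U hδ hτ hσ hU hfam =>
    hC δ τ σ U hδ hτ hσ hU (fun S hS1 hS2 => ?_)⟩
  obtain ⟨ι, _, Q, hdeg, hh, hsmall, hzero⟩ := hfam S hS1 hS2
  have hm1 : (1 : ℝ) ≤ m := by exact_mod_cast (show 1 ≤ m by omega)
  have h1τ : 1 ≤ τ := by nlinarith
  exact exists_homogeneous_family_of_affine θ h1τ Q hdeg hh hsmall hzero

end QuantCIA

end Literature.NumberTheory.Transcendental

end
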